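import Summits.Ventures.CertifiedManyBodySolver.Observables.PairLROTowerChargedReading
import Summits.Ventures.CertifiedManyBodySolver.Observables.PairLROOnePointTwisted
import Literature.MathematicalPhysics.QuantumLattice.LocalUnitaryDressedSlaterBound
import HarnessLib

/-!
# OP1-C, part 9: the CHARGED equation-of-motion term under the TWISTED identification — gauge conjugation of
# embedded words and the twisted space-group average

HONEST FRAMING: first certified bounds on pairing observables; not a superconductivity verdict; a ceiling route,
never presence; nothing in this file is a number. Crew hubbard-obs (D-0042), seat hubbard-obs-p1
(`prover-hubbard-obs-p1-g9-0`); lead RULINGS (eo) d181 / (ex) d190; PAIRCORR-SDP §15.8 EXPORT RULE. Zero compute;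
no definition; no named fact; no `sorry`.

eng-2's node-grade one-point objects (the j248069 class) are built under the TWISTED identification
`T((v,γ),m) = U_v D_γ 𝒢_{j(γ)+2m}` (`twistedSpaceGroupUnitary`; W8, PairLROOnePointTwisted): the `b₁g`-odd lattice
elements are composed with the gauge quarter turn `𝒢_k = i^{kN̂}`, under which a charge-`q` word picks up `i^{kq}`.
For an OP1-C node typed in twisted orbit-state form the charged eom term is
`Re ω̄^{tw}_ζ(K_L Γ_L X − Γ_L X K_L)`, `K_L = H_L − μ'N̂`. This file reads it:

* `fockGauge_conj_fermionEmbed` — **`𝒢_k Γ(φ)A 𝒢_kᴴ = Γ(φ)(𝒢_k A 𝒢_kᴴ)`**: the gauge rotation of the big algebra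
  restricts to the gauge rotation of the window algebra (checked on matrix units, which have definite charge;
  `fockGauge_conj_of_totalNumberOp_commutator`), so NO charge decomposition of `X` is needed — the phases
  `i^{kq}` of its components are produced inside `Γ`;
* `fockGauge_conj_mem_carEvenSubalgebra`, `conjTranspose_fockGauge_conj`,
  `norm_totalNumberOp_commutator_fockGauge_conj_le` — the gauge-conjugated word `X^{(k)} = 𝒢_k X 𝒢_kᴴ` is even
  (with even adjoint) when `X` is, and `‖N̂₀X^{(k)} − X^{(k)}N̂₀‖ ≤ ‖N̂₀X − XN̂₀‖` (`𝒢_k` unitary, commutes with `N̂₀`);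
* **`orbitState_twistedSpaceGroupUnitary_commutator_fermionEmbed_of_invariant`** — for `K` invariant under
  `D₄`, translations and commuting with `N̂`:
  `ω̄^{tw}_ζ([K, Γ_L X]) = (2|S|)⁻¹ Σ_{γ∈S} Σ_{m} L⁻² ⟨ζ, [K, W_{γ,m}] ζ⟩`,
  `W_{γ,m} = Σ_v T_v Γ_{L,γΛ'}(Γ(d4Emb γ 0 Λ') X^{(j(γ)+2m)})`;
* `sum_translate_twistedSpaceGroupAverage_eq` — `Σ_{γ,m} W_{γ,m}` is ONE translation sum of the symmetrised
  word `Σ_{γ,m} Γ(incl)Γ(d4Emb γ) X^{(j(γ)+2m)} ∈ 𝔄_Ω`.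

The family theorem and the leaf consumer follow in PairLROTowerChargedReadingTwisted.
References: O. Bratteli, D. W. Robinson, *Operator Algebras and Quantum Statistical Mechanics 2* (1997) §5.2.2,
§6.2.4 [BratteliRobinsonII1997]; X. Han, arXiv:2006.06002, §3 [Han2020Bootstrap]; T. Koma, H. Tasaki, J. Stat.
Phys. 76 (1994) 745 [KomaTasaki1994].
-/

noncomputable section

namespace Summit.Ventures.CertifiedManyBodySolver.Observables

open Matrix Complex Finset Literature.MathematicalPhysics.QuantumLattice Literature.Probability.LatticeModels
open Literature.MathematicalPhysics.QuantumLattice.HubbardWave0 ThermodynamicLimit Filter Topology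
open Literature.MathematicalPhysics.QuantumManyBody.StateRelaxation
open Summit.Ventures.CertifiedManyBodySolver.Transport
open scoped ComplexOrder ComplexConjugate BigOperators Matrix.Norms.L2Operator

/-! ### §1  Gauge conjugation commutes with the embedding `Γ(φ)` -/

section GaugeEmbed

variable {Λ Λ' : Type*} [LinearOrder Λ] [Fintype Λ] [LinearOrder Λ'] [Fintype Λ']

/-- **`𝒢_k Γ(φ)A 𝒢_kᴴ = Γ(φ)(𝒢_k A 𝒢_kᴴ)`**: conjugation by the gauge rotation `i^{kN̂}` of `𝔄(Λ')` restricts along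
`Γ(φ) : 𝔄(Λ) → 𝔄(Λ')` to conjugation by the gauge rotation of `𝔄(Λ)`. Both sides are linear in `A`; on a
matrix unit `|s⟩⟨t|` (charge `#s − #t`, preserved by `Γ(φ)`: `totalNumberOp_commutator_fermionEmbed`) both are
multiplication by `i^{k(#s−#t)}`. [cite: BratteliRobinsonII1997, §5.2.2] -/
theorem fockGauge_conj_fermionEmbed (φ : Λ ↪ Λ') (k : ℕ) (A : Matrix (Finset (Orb Λ)) (Finset (Orb Λ)) ℂ) :
    fockGauge k * fermionEmbed φ A * (fockGauge k)ᴴ = fermionEmbed φ (fockGauge k * A * (fockGauge k)ᴴ) := by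
  have key : ∀ s t : Finset (Orb Λ),
      fockGauge k * fermionEmbed φ (single s t (1 : ℂ)) * (fockGauge k)ᴴ =
        fermionEmbed φ (fockGauge k * single s t (1 : ℂ) * (fockGauge k)ᴴ) := by
    intro s t
    have hcast : ((((s.card : ℤ) - (t.card : ℤ) : ℤ)) : ℂ) = (s.card : ℂ) - (t.card : ℂ) := by push_cast; rfl
    have hq : totalNumberOp * single s t (1 : ℂ) - single s t 1 * totalNumberOp =
        ((((s.card : ℤ) - (t.card : ℤ) : ℤ)) : ℂ) • single s t (1 : ℂ) := by
      rw [totalNumberOp_commutator_single, hcast]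
    have hq' : totalNumberOp * fermionEmbed φ (single s t (1 : ℂ)) - fermionEmbed φ (single s t 1) * totalNumberOp =
        ((((s.card : ℤ) - (t.card : ℤ) : ℤ)) : ℂ) • fermionEmbed φ (single s t (1 : ℂ)) := by
      rw [totalNumberOp_commutator_fermionEmbed, hq, fermionEmbed_smul]
    rw [fockGauge_conj_of_totalNumberOp_commutator hq' k, fockGauge_conj_of_totalNumberOp_commutator hq k,
      fermionEmbed_smul]
  conv_lhs => rw [Matrix.matrix_eq_sum_single A]
  conv_rhs => rw [Matrix.matrix_eq_sum_single A]
  rw [fermionEmbed_sum, Finset.mul_sum, Finset.sum_mul, Finset.mul_sum, Finset.sum_mul, fermionEmbed_sum]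
  refine Finset.sum_congr rfl fun s _ => ?_
  rw [fermionEmbed_sum, Finset.mul_sum, Finset.sum_mul, Finset.mul_sum, Finset.sum_mul, fermionEmbed_sum]
  refine Finset.sum_congr rfl fun t _ => ?_
  rw [show single s t (A s t) = A s t • single s t (1 : ℂ) by rw [Matrix.smul_single, smul_eq_mul, mul_one],
    fermionEmbed_smul, Matrix.mul_smul, Matrix.smul_mul, key, Matrix.mul_smul, Matrix.smul_mul, fermionEmbed_smul]

end GaugeEmbed

/-! ### §2  The gauge-conjugated word `X^{(k)} = 𝒢_k X 𝒢_kᴴ`: evenness, adjoint, charge -/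

section GaugeWord

variable {ι : Type*} [LinearOrder ι] [Fintype ι]

/-- `𝒢_k` is unitary. [cite: BratteliRobinsonII1997, §5.2.2] -/
theorem fockGauge_mem_unitary (k : ℕ) :
    (fockGauge k : Matrix (Finset ι) (Finset ι) ℂ) ∈ unitary (Matrix (Finset ι) (Finset ι) ℂ) :=
  Unitary.mem_iff.2 ⟨fockGauge_conjTranspose_mul_self k, fockGauge_mul_conjTranspose_self k⟩

/-- `𝒢_k = i^{kN̂}` is an even operator (it commutes with `N̂`). [cite: BratteliRobinsonII1997, §5.2.2] -/
theorem fockGauge_mem_carEvenSubalgebra (k : ℕ) :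
    (fockGauge k : Matrix (Finset ι) (Finset ι) ℂ) ∈ carEvenSubalgebra (Finset.univ : Finset ι) :=
  mem_carEvenSubalgebra_univ_of_commute_totalNumberOp (Commute.fockGauge_of_totalNumberOp (Commute.refl _) k).symm

/-- **The gauge-conjugated word is even** when the word is. [cite: BratteliRobinsonII1997, §5.2.2] -/
theorem fockGauge_conj_mem_carEvenSubalgebra {X : Matrix (Finset ι) (Finset ι) ℂ}
    (hX : X ∈ carEvenSubalgebra (Finset.univ : Finset ι)) (k : ℕ) :
    fockGauge k * X * (fockGauge k)ᴴ ∈ carEvenSubalgebra (Finset.univ : Finset ι) := by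
  rw [conjTranspose_fockGauge]
  exact Subalgebra.mul_mem _ (Subalgebra.mul_mem _ (fockGauge_mem_carEvenSubalgebra k) hX)
    (fockGauge_mem_carEvenSubalgebra _)

/-- `(𝒢_k X 𝒢_kᴴ)ᴴ = 𝒢_k Xᴴ 𝒢_kᴴ`. [folklore] -/
theorem conjTranspose_fockGauge_conj (k : ℕ) (X : Matrix (Finset ι) (Finset ι) ℂ) :
    (fockGauge k * X * (fockGauge k)ᴴ)ᴴ = fockGauge k * Xᴴ * (fockGauge k)ᴴ := by
  rw [conjTranspose_mul, conjTranspose_mul, conjTranspose_conjTranspose, Matrix.mul_assoc]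

/-- `N̂₀ X^{(k)} − X^{(k)} N̂₀ = 𝒢_k (N̂₀X − XN̂₀) 𝒢_kᴴ` (`𝒢_k` commutes with `N̂₀`). [cite: BratteliRobinsonII1997, §5.2.2] -/
theorem totalNumberOp_commutator_fockGauge_conj (k : ℕ) (X : Matrix (Finset ι) (Finset ι) ℂ) :
    totalNumberOp * (fockGauge k * X * (fockGauge k)ᴴ) - (fockGauge k * X * (fockGauge k)ᴴ) * totalNumberOp =
      fockGauge k * (totalNumberOp * X - X * totalNumberOp) * (fockGauge k)ᴴ := by
  have h1 : totalNumberOp * (fockGauge k : Matrix (Finset ι) (Finset ι) ℂ) = fockGauge k * totalNumberOp :=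
    (Commute.fockGauge_of_totalNumberOp (Commute.refl _) k).eq.symm
  have h2 : (fockGauge k : Matrix (Finset ι) (Finset ι) ℂ)ᴴ * totalNumberOp = totalNumberOp * (fockGauge k)ᴴ := by
    rw [conjTranspose_fockGauge]
    exact (Commute.fockGauge_of_totalNumberOp (Commute.refl _) _).eq
  rw [Matrix.mul_sub, Matrix.sub_mul]
  simp only [Matrix.mul_assoc]
  rw [h2, ← Matrix.mul_assoc totalNumberOp (fockGauge k) (X * (fockGauge k)ᴴ), h1, Matrix.mul_assoc]

/-- `‖𝒢_k‖ ≤ 1` (a unitary). [cite: BratteliRobinsonII1997, §5.2.2] -/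
theorem norm_fockGauge_le_one (k : ℕ) : ‖(fockGauge k : Matrix (Finset ι) (Finset ι) ℂ)‖ ≤ 1 := by
  have h := Matrix.l2_opNorm_conjTranspose_mul_self (fockGauge k : Matrix (Finset ι) (Finset ι) ℂ)
  rw [fockGauge_conjTranspose_mul_self] at h
  have h1 : ‖(1 : Matrix (Finset ι) (Finset ι) ℂ)‖ ≤ 1 := by
    have h0 := norm_ladderWord_le_one ([] : List (ι × Bool))
    rwa [ladderWord_nil] at h0
  nlinarith [norm_nonneg (fockGauge k : Matrix (Finset ι) (Finset ι) ℂ)]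

/-- **The gauge-conjugated word has the same operator-norm charge**: `‖N̂₀X^{(k)} − X^{(k)}N̂₀‖ ≤ ‖N̂₀X − XN̂₀‖`
(`𝒢_k` has norm `≤ 1` and commutes with `N̂₀`). [cite: BratteliRobinsonII1997, §5.2.2] -/
theorem norm_totalNumberOp_commutator_fockGauge_conj_le (k : ℕ) (X : Matrix (Finset ι) (Finset ι) ℂ) :
    ‖totalNumberOp * (fockGauge k * X * (fockGauge k)ᴴ) - (fockGauge k * X * (fockGauge k)ᴴ) * totalNumberOp‖ ≤
      ‖totalNumberOp * X - X * totalNumberOp‖ := by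
  rw [totalNumberOp_commutator_fockGauge_conj]
  set C : Matrix (Finset ι) (Finset ι) ℂ := totalNumberOp * X - X * totalNumberOp
  have hG := norm_fockGauge_le_one (ι := ι) k
  have hGH : ‖(fockGauge k : Matrix (Finset ι) (Finset ι) ℂ)ᴴ‖ ≤ 1 := by
    rw [conjTranspose_fockGauge]; exact norm_fockGauge_le_one _
  calc ‖fockGauge k * C * (fockGauge k)ᴴ‖
      ≤ ‖fockGauge k * C‖ * ‖(fockGauge k : Matrix (Finset ι) (Finset ι) ℂ)ᴴ‖ := norm_mul_le _ _
    _ ≤ (‖(fockGauge k : Matrix (Finset ι) (Finset ι) ℂ)‖ * ‖C‖) * 1 :=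
        mul_le_mul (norm_mul_le _ _) hGH (norm_nonneg _) (by positivity)
    _ ≤ (1 * ‖C‖) * 1 := by gcongr
    _ = ‖C‖ := by ring

end GaugeWord

/-! ### §3  The twisted space-group average of a CHARGED equation-of-motion term -/

section TwistedReading

variable {L : ℕ} [NeZero L]

/-- `expect` is additive over finite sums. [folklore] -/
private theorem expect_finset_sum₃ {ι κ : Type*} [LinearOrder ι] [Fintype ι] (s : Finset κ)
    (f : κ → Matrix (Finset ι) (Finset ι) ℂ) (ψ : Fock ι) :
    expect (∑ k ∈ s, f k) ψ = ∑ k ∈ s, expect (f k) ψ := by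
  unfold Literature.MathematicalPhysics.QuantumLattice.expect
  rw [Matrix.sum_mulVec, dotProduct_sum]

/-- `⟨Mᴴφ, A Mᴴφ⟩ = ⟨φ, (M A Mᴴ) φ⟩`. [folklore] -/
private theorem expect_conjTranspose_mulVec₃ {ι : Type*} [LinearOrder ι] [Fintype ι]
    (A M : Matrix (Finset ι) (Finset ι) ℂ) (φ : Fock ι) :
    expect A (Mᴴ *ᵥ φ) = expect (M * A * Mᴴ) φ := by
  unfold Literature.MathematicalPhysics.QuantumLattice.expect
  rw [star_mulVec, conjTranspose_conjTranspose, ← dotProduct_mulVec, mulVec_mulVec, mulVec_mulVec]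

/-- `relabel π [K, Z] = [K, relabel π Z]` when `π` fixes `K`. [folklore] -/
private theorem relabel_commutator_of_fixed {ι : Type*} [LinearOrder ι] [Fintype ι] (π : Equiv.Perm ι)
    {K : Matrix (Finset ι) (Finset ι) ℂ} (hK : relabel π K = K) (Z : Matrix (Finset ι) (Finset ι) ℂ) :
    relabel π (K * Z - Z * K) = K * relabel π Z - relabel π Z * K := by
  rw [relabel_sub, relabel_mul, relabel_mul, hK]

/-- **The twisted-orbit state of a commutator with an invariant, number-conserving torus operator.** For a finite
`S ⊆ D₄`, a window `Λ'` fitting into the torus, `X ∈ 𝔄_{Λ'}`, a torus operator `K` invariant under the point group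
and the translations and commuting with `N̂` (`K = H_L − μ'N̂`), and any torus vector `ζ`:
`ω̄^{tw}_ζ(K Γ_L X − Γ_L X K) = (2|S|)⁻¹ Σ_{γ∈S} Σ_{m∈{0,1}} L⁻² ⟨ζ, (K W_{γ,m} − W_{γ,m} K) ζ⟩`,
`W_{γ,m} = Σ_v T_v Γ_{L,γΛ'}(Γ(d4Emb γ 0 Λ')(𝒢_{j(γ)+2m} X 𝒢ᴴ_{j(γ)+2m}))` — the member `U_v D_γ 𝒢_k` conjugates
`Γ_L X` to the translate of the rotated GAUGE-CONJUGATED word (`fockGauge_conj_fermionEmbed`) and commutes with `K`.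
[cite: BratteliRobinsonII1997, §6.2.4] [cite: Han2020Bootstrap, §3] -/
theorem orbitState_twistedSpaceGroupUnitary_commutator_fermionEmbed_of_invariant (S : Finset (DihedralGroup 4))
    (K : Matrix (Finset (Orb (FermionTorus 2 L))) (Finset (Orb (FermionTorus 2 L))) ℂ)
    (hKD : ∀ γ : DihedralGroup 4, relabel (Orb.d4Perm (L := L) γ) K = K)
    (hKT : ∀ v : TorusSite 2 L, relabel (Orb.translate v) K = K)
    (hKN : Commute totalNumberOp K)
    {Λ' : Finset (Site 2)} (hInj' : Set.InjOn (Torus.proj (d := 2) L) ↑Λ') (X : FermionOp Λ')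
    (ζ : Fock (Orb (FermionTorus 2 L))) :
    orbitState (twistedSpaceGroupUnitary S) ζ
        (K * fermionEmbed (PolySite.toTorusEmb L hInj') X - fermionEmbed (PolySite.toTorusEmb L hInj') X * K) =
      ((S.card : ℂ) * 2)⁻¹ * ∑ γ ∈ S, ∑ m : Fin 2, ((Fintype.card (TorusSite 2 L) : ℂ))⁻¹ *
        expect (K *
            (∑ v : TorusSite 2 L, relabel (Orb.translate v)
              (fermionEmbed (PolySite.toTorusEmb L ((injOn_proj_d4ShiftSet_iff L γ 0 Λ').2 hInj'))
                (fermionEmbed (PolySite.d4Emb γ 0 Λ')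
                  (fockGauge (twistExp γ m) * X * (fockGauge (twistExp γ m))ᴴ)))) -
          (∑ v : TorusSite 2 L, relabel (Orb.translate v)
              (fermionEmbed (PolySite.toTorusEmb L ((injOn_proj_d4ShiftSet_iff L γ 0 Λ').2 hInj'))
                (fermionEmbed (PolySite.d4Emb γ 0 Λ')
                  (fockGauge (twistExp γ m) * X * (fockGauge (twistExp γ m))ᴴ)))) * K) ζ := by
  set Y := fermionEmbed (PolySite.toTorusEmb L hInj') X with hY
  -- the rotated gauge-conjugated word and its translation sum
  have hInjγ : ∀ γ : DihedralGroup 4, Set.InjOn (Torus.proj (d := 2) L) ↑(d4ShiftSet γ 0 Λ') := fun γ =>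
    (injOn_proj_d4ShiftSet_iff L γ 0 Λ').2 hInj'
  set Yc : DihedralGroup 4 → Fin 2 → Matrix (Finset (Orb (FermionTorus 2 L))) (Finset (Orb (FermionTorus 2 L))) ℂ :=
    fun γ m => fermionEmbed (PolySite.toTorusEmb L (hInjγ γ))
      (fermionEmbed (PolySite.d4Emb γ 0 Λ') (fockGauge (twistExp γ m) * X * (fockGauge (twistExp γ m))ᴴ)) with hYc
  -- each member conjugates `[K, Y]` to `[K, T_v Yc γ m]`
  have hG : ∀ k : ℕ, fockGauge k * (K * Y - Y * K) * (fockGauge k)ᴴ =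
      K * (fockGauge k * Y * (fockGauge k)ᴴ) - (fockGauge k * Y * (fockGauge k)ᴴ) * K := by
    intro k
    have h1 : fockGauge k * K = K * fockGauge k := (Commute.fockGauge_of_totalNumberOp hKN k).eq
    have h2 : K * (fockGauge k)ᴴ = (fockGauge k)ᴴ * K := by
      rw [conjTranspose_fockGauge]
      exact ((Commute.fockGauge_of_totalNumberOp hKN _).eq).symm
    rw [Matrix.mul_sub, Matrix.sub_mul]
    simp only [Matrix.mul_assoc]
    rw [← h2, ← Matrix.mul_assoc (fockGauge k) K (Y * (fockGauge k)ᴴ), h1, Matrix.mul_assoc]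
  have hproj0 : Torus.proj L (0 : Site 2) = 0 := by
    funext i
    simp [Torus.proj]
  have hrot : ∀ (γ : DihedralGroup 4) (m : Fin 2),
      relabel (Orb.d4Perm (L := L) γ) (fockGauge (twistExp γ m) * Y * (fockGauge (twistExp γ m))ᴴ) = Yc γ m := by
    intro γ m
    rw [hY, fockGauge_conj_fermionEmbed]
    simp only [hYc]
    rw [fermionEmbed_toTorusEmb_d4Emb γ 0 hInj' (hInjγ γ), hproj0, Orb.translate_zero, Equiv.Perm.one_def,
      relabel_refl]
  have hterm : ∀ (v : TorusSite 2 L) (γ : ↥S) (m : Fin 2),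
      Literature.MathematicalPhysics.QuantumManyBody.StateRelaxation.vectorState
          ((twistedSpaceGroupUnitary S ((v, γ), m))ᴴ *ᵥ ζ) (K * Y - Y * K) =
        expect (K * relabel (Orb.translate v) (Yc γ m) - relabel (Orb.translate v) (Yc γ m) * K) ζ := by
    rintro v ⟨γ, hγ⟩ m
    rw [Literature.MathematicalPhysics.QuantumManyBody.StateRelaxation.vectorState_apply,
      show star ((twistedSpaceGroupUnitary S ((v, ⟨γ, hγ⟩), m))ᴴ *ᵥ ζ) ⬝ᵥ
          (K * Y - Y * K) *ᵥ ((twistedSpaceGroupUnitary S ((v, ⟨γ, hγ⟩), m))ᴴ *ᵥ ζ) =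
        expect (K * Y - Y * K) ((twistedSpaceGroupUnitary S ((v, ⟨γ, hγ⟩), m))ᴴ *ᵥ ζ) from rfl,
      expect_conjTranspose_mulVec₃, twistedSpaceGroupUnitary_apply]
    simp only
    rw [conjTranspose_mul,
      show spaceGroupUnitary S (v, ⟨γ, hγ⟩) * fockGauge (twistExp γ m) * (K * Y - Y * K) *
          ((fockGauge (twistExp γ m))ᴴ * (spaceGroupUnitary S (v, ⟨γ, hγ⟩))ᴴ) =
        spaceGroupUnitary S (v, ⟨γ, hγ⟩) *
          (fockGauge (twistExp γ m) * (K * Y - Y * K) * (fockGauge (twistExp γ m))ᴴ) *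
          (spaceGroupUnitary S (v, ⟨γ, hγ⟩))ᴴ by simp only [Matrix.mul_assoc],
      hG,
      show spaceGroupUnitary S (v, ⟨γ, hγ⟩) *
          (K * (fockGauge (twistExp γ m) * Y * (fockGauge (twistExp γ m))ᴴ) -
            fockGauge (twistExp γ m) * Y * (fockGauge (twistExp γ m))ᴴ * K) *
          (spaceGroupUnitary S (v, ⟨γ, hγ⟩))ᴴ =
        (fockTranslate v).val * (fockD4 (L := L) γ).val *
          (K * (fockGauge (twistExp γ m) * Y * (fockGauge (twistExp γ m))ᴴ) -
            fockGauge (twistExp γ m) * Y * (fockGauge (twistExp γ m))ᴴ * K) *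
          ((fockTranslate v).val * (fockD4 (L := L) γ).val)ᴴ from rfl,
      d4Affine_conj, relabel_commutator_of_fixed _ (hKD γ), hrot γ m, relabel_commutator_of_fixed _ (hKT v)]
  -- sum over the family
  rw [orbitState_apply, Fintype.sum_prod_type, Fintype.sum_prod_type]
  simp_rw [hterm]
  have hinner : ∀ (γ : ↥S) (m : Fin 2),
      ∑ v : TorusSite 2 L, expect (K * relabel (Orb.translate v) (Yc γ m) - relabel (Orb.translate v) (Yc γ m) * K) ζ =
        expect (K * (∑ v : TorusSite 2 L, relabel (Orb.translate v) (Yc γ m)) -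
          (∑ v : TorusSite 2 L, relabel (Orb.translate v) (Yc γ m)) * K) ζ := by
    intro γ m
    rw [Finset.mul_sum, Finset.sum_mul, ← Finset.sum_sub_distrib, expect_finset_sum₃]
  rw [Finset.sum_comm (s := (Finset.univ : Finset (TorusSite 2 L))) (t := (Finset.univ : Finset ↥S))]
  have hswap : ∀ γ : ↥S, ∑ v : TorusSite 2 L, ∑ m : Fin 2,
      expect (K * relabel (Orb.translate v) (Yc γ m) - relabel (Orb.translate v) (Yc γ m) * K) ζ =
        ∑ m : Fin 2, expect (K * (∑ v : TorusSite 2 L, relabel (Orb.translate v) (Yc γ m)) -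
          (∑ v : TorusSite 2 L, relabel (Orb.translate v) (Yc γ m)) * K) ζ := by
    intro γ
    rw [Finset.sum_comm (s := (Finset.univ : Finset (TorusSite 2 L))) (t := (Finset.univ : Finset (Fin 2)))]
    exact Finset.sum_congr rfl fun m _ => hinner γ m
  rw [Finset.sum_congr rfl fun γ _ => hswap γ,
    Finset.sum_coe_sort S (fun γ : DihedralGroup 4 => ∑ m : Fin 2,
      expect (K * (∑ v : TorusSite 2 L, relabel (Orb.translate v) (Yc γ m)) -
        (∑ v : TorusSite 2 L, relabel (Orb.translate v) (Yc γ m)) * K) ζ)]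
  simp_rw [← Finset.mul_sum]
  rw [← mul_assoc, Fintype.card_prod, Fintype.card_prod, Fintype.card_coe, Fintype.card_fin]
  have hS : (((Fintype.card (TorusSite 2 L) * S.card * 2 : ℕ)) : ℂ)⁻¹ =
      ((S.card : ℂ) * 2)⁻¹ * ((Fintype.card (TorusSite 2 L) : ℂ))⁻¹ := by
    push_cast
    rw [mul_inv, mul_inv, mul_inv]; ring
  rw [hS]

/-- **The twisted space-group sum of the rotated translation sums is ONE translation sum** of the symmetrised
gauge-conjugated word: with `Ω ⊇ γΛ'` for all `γ ∈ S`,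
`Σ_{γ∈S} Σ_m W_{γ,m} = Σ_v T_v Γ_{L,Ω}(Σ_{γ∈S} Σ_m Γ(incl)(Γ(d4Emb γ 0 Λ') X^{(j(γ)+2m)}))`.
[cite: BratteliRobinsonII1997, §6.2.4] -/
theorem sum_translate_twistedSpaceGroupAverage_eq (S : Finset (DihedralGroup 4)) {Λ' Ω : Finset (Site 2)}
    (hInj' : Set.InjOn (Torus.proj (d := 2) L) ↑Λ') (hΩ : Set.InjOn (Torus.proj (d := 2) L) ↑Ω)
    (hsub : ∀ γ ∈ S, d4ShiftSet γ 0 Λ' ⊆ Ω) (X : FermionOp Λ') :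
    ∑ γ ∈ S, ∑ m : Fin 2, (∑ v : TorusSite 2 L, relabel (Orb.translate v)
        (fermionEmbed (PolySite.toTorusEmb L ((injOn_proj_d4ShiftSet_iff L γ 0 Λ').2 hInj'))
          (fermionEmbed (PolySite.d4Emb γ 0 Λ') (fockGauge (twistExp γ m) * X * (fockGauge (twistExp γ m))ᴴ)))) =
      ∑ v : TorusSite 2 L, relabel (Orb.translate v) (fermionEmbed (PolySite.toTorusEmb L hΩ)
        (∑ γ ∈ S.attach, ∑ m : Fin 2, fermionEmbed (PolySite.incl (hsub γ.1 γ.2))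
          (fermionEmbed (PolySite.d4Emb γ.1 0 Λ') (fockGauge (twistExp γ.1 m) * X * (fockGauge (twistExp γ.1 m))ᴴ)))) := by
  have hR : ∀ v : TorusSite 2 L, relabel (Orb.translate v) (fermionEmbed (PolySite.toTorusEmb L hΩ)
      (∑ γ ∈ S.attach, ∑ m : Fin 2, fermionEmbed (PolySite.incl (hsub γ.1 γ.2))
        (fermionEmbed (PolySite.d4Emb γ.1 0 Λ') (fockGauge (twistExp γ.1 m) * X * (fockGauge (twistExp γ.1 m))ᴴ)))) =
      ∑ γ ∈ S, ∑ m : Fin 2, relabel (Orb.translate v)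
        (fermionEmbed (PolySite.toTorusEmb L ((injOn_proj_d4ShiftSet_iff L γ 0 Λ').2 hInj'))
          (fermionEmbed (PolySite.d4Emb γ 0 Λ') (fockGauge (twistExp γ m) * X * (fockGauge (twistExp γ m))ᴴ))) := by
    intro v
    rw [fermionEmbed_sum, relabel_sum, ← Finset.sum_attach S]
    refine Finset.sum_congr rfl fun γ _ => ?_
    rw [fermionEmbed_sum, relabel_sum]
    refine Finset.sum_congr rfl fun m _ => ?_
    rw [fermionEmbed_toTorusEmb_incl (hsub γ.1 γ.2) hΩ]
  simp_rw [hR]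
  rw [Finset.sum_comm (s := (Finset.univ : Finset (TorusSite 2 L))) (t := S)]
  refine Finset.sum_congr rfl fun γ _ => ?_
  rw [Finset.sum_comm (s := (Finset.univ : Finset (Fin 2))) (t := (Finset.univ : Finset (TorusSite 2 L)))]

end TwistedReading

end Summit.Ventures.CertifiedManyBodySolver.Observables

end
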